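import Summits.ABC.ABC.Theorems.PadicPrimesYuNinetyRung
import HarnessLib

/-!
# BC5 rungs for the Waldschmidt-binder texts (routes PadicPrimesW80TwoThirds / PadicPrimesYuNinetyOddRadOne)

`Summits/ABC/ABC/Theorems/PadicPrimesW80Rung.lean` — cell `abc-stewartyu` (planner-staged; any prover
files it `--supports <W80ThreeModFour item>`). The three W80-binder crux texts
(`(c₅ #S)^{#S} · p² · (log B + log log A) · log log A · ∏ log max(4,q)`) in the ONE-PRIME case
`#S ≤ 1`, from the Yu-binder rungs of `PadicPrimesYuNinetyRung.lean` (p419359): the Yu binder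
`log B · log log A` is at most the Waldschmidt binder since `log log A ≥ 0`.
-/

set_option linter.dupNamespace false

open Summit.ABC.ABC.Theorems.PadicPrimesYuNinetyRung
namespace Summit.ABC.ABC.Theorems.PadicPrimesW80Rung

/-- Monotonicity: a Yu-binder bound with constant `c` gives the Waldschmidt-binder bound with `|c|`. [folklore] -/
theorem w80_of_yu_tail {c p LB LLA P v : ℝ} (n : ℕ) (_hp : 0 ≤ p) (hLB : 0 ≤ LB) (hLLA : 0 ≤ LLA)
    (hP : 0 ≤ P) (hv : v < (c * n) ^ n * p ^ 2 * LB * LLA * P) :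
    v < (|c| * n) ^ n * p ^ 2 * ((LB + LLA) * LLA) * P := by
  have hpow : (c * n) ^ n ≤ (|c| * n) ^ n := by
    calc (c * n) ^ n ≤ |(c * n) ^ n| := le_abs_self _
      _ = (|c| * n) ^ n := by rw [abs_pow, abs_mul, Nat.abs_cast]
  have hbin : LB * LLA ≤ (LB + LLA) * LLA := by nlinarith
  refine lt_of_lt_of_le hv ?_
  have h0 : 0 ≤ (|c| * n) ^ n := by positivity
  calc (c * n) ^ n * p ^ 2 * LB * LLA * P
      = (c * n) ^ n * (p ^ 2 * (LB * LLA) * P) := by ring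
    _ ≤ (|c| * n) ^ n * (p ^ 2 * (LB * LLA) * P) :=
        mul_le_mul_of_nonneg_right hpow (by positivity)
    _ ≤ (|c| * n) ^ n * (p ^ 2 * ((LB + LLA) * LLA) * P) := by
        apply mul_le_mul_of_nonneg_left _ h0
        exact mul_le_mul_of_nonneg_right (mul_le_mul_of_nonneg_left hbin (by positivity)) hP
    _ = _ := by ring

/-- The three tails are nonnegative: `log B ≥ 0` (`B ≥ 3`), `log log max(4, A) ≥ 0`, `∏ log max(4,q) ≥ 0`. [folklore] -/
private theorem tails (S : Finset ℕ) (B : ℝ) (hB : 3 ≤ B) :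
    0 ≤ Real.log B ∧ 0 ≤ Real.log (Real.log ((max 4 (S.sup id) : ℕ) : ℝ)) ∧
      0 ≤ ∏ q ∈ S, Real.log ((max 4 q : ℕ) : ℝ) := by
  refine ⟨Real.log_nonneg (by linarith), ?_, ?_⟩
  · have := loglog_max_four_ge (S.sup id); linarith
  · exact Finset.prod_nonneg fun q _ =>
      Real.log_nonneg (by exact_mod_cast le_max_of_le_left (by norm_num))

/-- **Rung (BC5) for `W80ThreeModFour`**: the Waldschmidt-binder text at `p ≡ 3 (mod 4)` when `#S ≤ 1`. [folklore] -/
theorem w80ThreeModFour_rung : ∃ c₅ : ℝ, ∀ (p : ℕ), p.Prime → p % 4 = 3 →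
    ∀ (S : Finset ℕ), (∀ q ∈ S, q.Prime) → p ∉ S → S.Nonempty → S.card ≤ 1 →
      ∀ (e : ℕ → ℤ) (B : ℝ), 3 ≤ B → (∀ q ∈ S, (|e q| : ℝ) ≤ B) →
      ∏ q ∈ S, (q : ℚ) ^ e q ≠ 1 →
      (padicValRat p (∏ q ∈ S, (q : ℚ) ^ e q - 1) : ℝ) <
        (c₅ * S.card) ^ S.card * (p : ℝ) ^ 2 *
          ((Real.log B + Real.log (Real.log ((max 4 (S.sup id) : ℕ) : ℝ))) *
            Real.log (Real.log ((max 4 (S.sup id) : ℕ) : ℝ))) *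
          ∏ q ∈ S, Real.log ((max 4 q : ℕ) : ℝ) := by
  obtain ⟨c₅, h⟩ := yuNinetyThreeModFour_rung
  refine ⟨|c₅|, fun p hp h3 S hS hpS hne hcard e B hB heB hne1 => ?_⟩
  obtain ⟨hLB, hLLA, hP⟩ := tails S B hB
  exact w80_of_yu_tail S.card (Nat.cast_nonneg p) hLB hLLA hP
    (h p hp h3 S hS hpS hne hcard e B hB heB hne1)

/-- **Rung (BC5) for `W80OneModFour`**: the Waldschmidt-binder text at `p ≡ 1 (mod 4)` when `#S ≤ 1`. [folklore] -/
theorem w80OneModFour_rung : ∃ c₅ : ℝ, ∀ (p : ℕ), p.Prime → p % 4 = 1 →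
    ∀ (S : Finset ℕ), (∀ q ∈ S, q.Prime) → p ∉ S → S.Nonempty → S.card ≤ 1 →
      ∀ (e : ℕ → ℤ) (B : ℝ), 3 ≤ B → (∀ q ∈ S, (|e q| : ℝ) ≤ B) →
      ∏ q ∈ S, (q : ℚ) ^ e q ≠ 1 →
      (padicValRat p (∏ q ∈ S, (q : ℚ) ^ e q - 1) : ℝ) <
        (c₅ * S.card) ^ S.card * (p : ℝ) ^ 2 *
          ((Real.log B + Real.log (Real.log ((max 4 (S.sup id) : ℕ) : ℝ))) *
            Real.log (Real.log ((max 4 (S.sup id) : ℕ) : ℝ))) *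
          ∏ q ∈ S, Real.log ((max 4 q : ℕ) : ℝ) := by
  obtain ⟨c₅, h⟩ := yuNinetyOneModFour_rung
  refine ⟨|c₅|, fun p hp h1 S hS hpS hne hcard e B hB heB hne1 => ?_⟩
  obtain ⟨hLB, hLLA, hP⟩ := tails S B hB
  exact w80_of_yu_tail S.card (Nat.cast_nonneg p) hLB hLLA hP
    (h p hp h1 S hS hpS hne hcard e B hB heB hne1)

/-- **Rung (BC5) for `W80Two`**: the Waldschmidt-binder text at `p = 2` when `#S ≤ 1`. [folklore] -/
theorem w80Two_rung : ∃ c₅ : ℝ,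
    ∀ (S : Finset ℕ), (∀ q ∈ S, q.Prime) → 2 ∉ S → S.Nonempty → S.card ≤ 1 →
      ∀ (e : ℕ → ℤ) (B : ℝ), 3 ≤ B → (∀ q ∈ S, (|e q| : ℝ) ≤ B) →
      ∏ q ∈ S, (q : ℚ) ^ e q ≠ 1 →
      (padicValRat 2 (∏ q ∈ S, (q : ℚ) ^ e q - 1) : ℝ) <
        (c₅ * S.card) ^ S.card * (2 : ℝ) ^ 2 *
          ((Real.log B + Real.log (Real.log ((max 4 (S.sup id) : ℕ) : ℝ))) *
            Real.log (Real.log ((max 4 (S.sup id) : ℕ) : ℝ))) *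
          ∏ q ∈ S, Real.log ((max 4 q : ℕ) : ℝ) := by
  obtain ⟨c₅, h⟩ := yuNinetyTwo_rung
  refine ⟨|c₅|, fun S hS h2S hne hcard e B hB heB hne1 => ?_⟩
  obtain ⟨hLB, hLLA, hP⟩ := tails S B hB
  exact w80_of_yu_tail S.card (by norm_num) hLB hLLA hP (h S hS h2S hne hcard e B hB heB hne1)

end Summit.ABC.ABC.Theorems.PadicPrimesW80Rung
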